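import Summits.QuantumFields.BalabanUV.InfraRed.StrongCouplingSixFifthsVariance
import Summits.QuantumFields.BalabanUV.InfraRed.StrongCouplingPoincareWindow

/-!
# `InfraRed.StrongCouplingSixFifthsWindow` — the `SU(2)` one-link KR modulus `√(2c)` on the ball `‖B‖_op ≤ 3/10` and
# the strong-coupling doors up to `β_W < √3/9` under the sharp one-link Poincaré hypothesis
# (lineage IR-SC, certificate J-SC11 part 3 of 3; cell `pub-balaban`)

HONEST FRAMING (verbatim, binding): «observatory of the non-perturbative crossover; no mass-gap claim».
Strong-coupling front of the two-front crossover ledger (IR-3 v2) for `SU(2)`, `d = 4`, Wilson action, `β_W = 4/g²`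
(tree bare coupling `β_W/2`, 't Hooft `β_W/4`).  Elementary and kernel-checked; NOT a statement about Bałaban's
renormalisation group, NOT the continuum, NOT Clay, NOT summit progress.

ABSOLUTE RULE.  No internally-minted statement may enter as a cited fact.  Every hypothesis is either kernel-proved in this
package or a verbatim quotation of a PUBLISHED theorem with page reference.  Nothing printed is used or cited in this file:
every statement is [folklore] real analysis about Mathlib's Haar probability measure, or a one-line feed into the tree's
doors.  The ONLY non-kernel input of the conditional statements is the explicit hypothesis
`OneLinkPoincareSU2 (3/10) (2/3)` (the schema of `InfraRed.StrongCouplingPoincareWindow`, R22 of the cell's FRONT-SC, at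
radius `3/10`: "tilting Haar on `SU(2) ≅ S³` by `e^{2 Re tr(g B)}`, `‖B‖_op ≤ 3/10`, keeps the Poincaré constant at the
Haar value `2/λ₁(S³) = 2/3` in Frobenius units") — OPEN, used only as a hypothesis, never asserted.

WHAT THIS FILE DOES.  R20 (`Literature/…/StrongCouplingVarianceWindow.lean`) bounds the variance of the perturbing
potential `w = 2 Re tr(g Δ)` under a one-link law by its Haar variance as long as the tilt satisfies `|2 Re tr(g B)| ≤ 1`,
i.e. `‖B‖_op ≤ 1/4`, i.e. `β_W ≤ 1/6`; that is why R22's conditional doors under the sharp Poincaré hypothesis stop at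
`β_W = 1/6` although the window inequality `81 β_W² (2/3) < 2` holds up to `β_W < √3/9 = 0.19245…`.  Parts 1–2
(`StrongCouplingSixFifthsMoments`, `StrongCouplingSixFifthsVariance`) extend R20's variance lemma to `|2 Re tr(g B)| ≤ 6/5`;
hence here (Part C, R22's covariance interpolation verbatim) `OneLinkPoincareSU2 R c → OneLinkKRModulus 2 R √(2c)` for
`R ≤ 3/10` (hypothesis-free corollary: the Bakry–Émery modulus `√(2/(1 − 2R))` now on `R ≤ 3/10`), and (Part D) under
`OneLinkPoincareSU2 (3/10) (2/3)` the three doors SC-a/SC-b/SC-c of the ledger open for every `0 ≤ β_W < √3/9 = 0.19245…`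
— the full sharp-Poincaré window (R22 stopped at `1/6`).  Plug-in form for ANY constant `c` on the ball of radius
`3/10` (a future partial result): doors on `81 β_W² c < 2`, `β_W ≤ 1/5` (`su2_*_of_poincare_threeTenths`).  OWNED, HYPOTHESIS-FREE NUMBER OF THE CELL: UNCHANGED
(`β_W ≤ 0.124`, R20; door ceiling `2/9`, `InfraRed.StrongCouplingDobrushinFloor`).
-/

open MeasureTheory Filter Topology ProbabilityTheory Finset Real
open scoped NNReal Quaternion
open Literature.Probability.LatticeModels
open Literature.MathematicalPhysics.QuantumLattice (fundamentalRep fundamentalLatticeRep quatMatrix su2Quat quatToSU2)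
open Literature.MathematicalPhysics.QuantumFieldTheory
open Literature.MathematicalPhysics.QuantumFieldTheory.Balaban1983to89
open Literature.MathematicalPhysics.QuantumFieldTheory.Balaban1983to89.StrongCouplingDobrushinWindow
open Literature.MathematicalPhysics.QuantumFieldTheory.Balaban1983to89.StrongCouplingTorusWindow
open Literature.MathematicalPhysics.QuantumFieldTheory.Balaban1983to89.StrongCouplingKernelWindow
open Literature.MathematicalPhysics.QuantumFieldTheory.Balaban1983to89.StrongCouplingOpenWindow
open Literature.MathematicalPhysics.QuantumFieldTheory.Balaban1983to89.StrongCouplingVarianceWindow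
open Summit.QuantumFields.BalabanUV.InfraRed.StrongCouplingSixFifthsVariance
open Summit.QuantumFields.BalabanUV.InfraRed.StrongCouplingPoincareWindow

noncomputable section

namespace Summit.QuantumFields.BalabanUV.InfraRed.StrongCouplingSixFifthsWindow


/-! ## Part C: the one-link KR modulus `√(2c)` on the ball `‖B‖_op ≤ 3/10` -/

section Modulus

/-- **`OneLinkPoincareSU2 R c → OneLinkKRModulus 2 R √(2c)`** for `R ≤ 3/10`, `0 < c` — R22's
`oneLinkKRModulus_two_of_poincare` verbatim (covariance interpolation along `ν_{(1−t)B + tB'}`, `Var φ ≤ c L²` from the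
schema, Cauchy–Schwarz) with the variance of the perturbing potential now from `integral_var_tilted_le_six_fifths`
(`|pot B_t| ≤ 4R ≤ 6/5`). [folklore] -/
theorem oneLinkKRModulus_two_of_poincare_threeTenths {R c : ℝ} (hR : R ≤ 3 / 10) (hc : 0 < c)
    (hP : OneLinkPoincareSU2 R c) :
    OneLinkKRModulus 2 R (Real.sqrt (2 * c)) := by
  classical
  intro B B' hB hB' φ L hφm hφb hL hφL
  set Kc : ℝ := Real.sqrt (2 * c) with hKc
  have hKc0 : 0 ≤ Kc := Real.sqrt_nonneg _
  have hKc2 : Kc ^ 2 = 2 * c := Real.sq_sqrt (by positivity)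
  have h2 : ((2 : ℕ) : ℝ) = 2 := by norm_num
  rw [h2]
  -- the potentials, with the real numeral `2`
  set f : (Matrix.specialUnitaryGroup (Fin 2) ℂ) → ℝ := fun g => (2 : ℝ) * (((g : (Matrix (Fin 2) (Fin 2) ℂ)) * B).trace.re) with hf
  set w : (Matrix.specialUnitaryGroup (Fin 2) ℂ) → ℝ := fun g => (2 : ℝ) * (((g : (Matrix (Fin 2) (Fin 2) ℂ)) * (B' - B)).trace.re) with hw
  have hfw : (fun g : (Matrix.specialUnitaryGroup (Fin 2) ℂ) => (2 : ℝ) * (((g : (Matrix (Fin 2) (Fin 2) ℂ)) * B').trace.re)) = fun g => f g + w g := by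
    funext g
    simp only [hf, hw, Matrix.mul_sub, Matrix.trace_sub, Complex.sub_re]
    ring
  rw [hfw, abs_sub_comm]
  have hfm : Measurable f := (continuous_const.mul (continuous_re_trace_su_mul B)).measurable
  have hwm : Measurable w := (continuous_const.mul (continuous_re_trace_su_mul (B' - B))).measurable
  have hfb : ∃ C, ∀ s, |f s| ≤ C := ⟨2 * (2 * matrixOpNorm B), fun s => by
    simp only [hf]
    rw [abs_mul, abs_two]
    exact mul_le_mul_of_nonneg_left (abs_re_trace_su2_mul_le_opNorm s B) zero_le_two⟩
  set Bw : ℝ := 2 * (Real.sqrt 2 * frobNorm (B' - B)) with hBw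
  have hwb : ∀ s, |w s| ≤ Bw := fun s => by
    simp only [hw, hBw]
    rw [abs_mul, abs_two]
    exact mul_le_mul_of_nonneg_left (abs_re_trace_su2_mul_le_frob s _) zero_le_two
  have key := abs_integral_tilted_add_sub_le_of_cov (μ := (haarProbability (Matrix.specialUnitaryGroup (Fin 2) ℂ))) (A := Kc * L * frobNorm (B' - B))
    hfm hfb hwm hwb hφm hφb ?_
  · rw [frobNorm_sub_comm]; exact key
  · intro t ht
    -- the interpolated tilt is the one-link law at `B_t`, `‖B_t‖_op ≤ R`
    set Bt : (Matrix (Fin 2) (Fin 2) ℂ) := B + (t : ℂ) • (B' - B) with hBt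
    have hft : (fun u : (Matrix.specialUnitaryGroup (Fin 2) ℂ) => f u + t * w u) = pot Bt := by
      funext g
      simp only [hf, hw, hBt, pot, Matrix.mul_add, Matrix.mul_smul, Matrix.trace_add, Matrix.trace_smul,
        Complex.add_re, smul_eq_mul, Complex.re_ofReal_mul]
      ring
    have hBt_le : matrixOpNorm Bt ≤ R := by
      have h1 : Bt = ((1 - t : ℝ) : ℂ) • B + ((t : ℝ) : ℂ) • B' := by
        rw [hBt]
        push_cast
        simp only [smul_sub, sub_smul, one_smul]
        abel
      rw [h1]
      calc matrixOpNorm (((1 - t : ℝ) : ℂ) • B + ((t : ℝ) : ℂ) • B')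
          ≤ matrixOpNorm (((1 - t : ℝ) : ℂ) • B) + matrixOpNorm (((t : ℝ) : ℂ) • B') := matrixOpNorm_add_le _ _
        _ = (1 - t) * matrixOpNorm B + t * matrixOpNorm B' := by
            rw [matrixOpNorm_smul, matrixOpNorm_smul, Complex.norm_real, Complex.norm_real, Real.norm_eq_abs,
              Real.norm_eq_abs, abs_of_nonneg (by linarith [ht.2]), abs_of_nonneg ht.1]
        _ ≤ (1 - t) * R + t * R :=
            add_le_add (mul_le_mul_of_nonneg_left hB (by linarith [ht.2])) (mul_le_mul_of_nonneg_left hB' ht.1)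
        _ = R := by ring
    rw [hft]
    set ν : Measure (Matrix.specialUnitaryGroup (Fin 2) ℂ) := Measure.tilted (haarProbability (Matrix.specialUnitaryGroup (Fin 2) ℂ)) (pot Bt) with hν
    have hFm : Measurable (pot Bt) := (continuous_const.mul (continuous_re_trace_su_mul Bt)).measurable
    have hFκ : ∀ s, |pot Bt s| ≤ 4 * R := fun s => by
      simp only [pot]
      rw [abs_mul, abs_two]
      calc 2 * |((s : (Matrix (Fin 2) (Fin 2) ℂ)) * Bt).trace.re| ≤ 2 * (2 * matrixOpNorm Bt) :=
            mul_le_mul_of_nonneg_left (abs_re_trace_su2_mul_le_opNorm s Bt) zero_le_two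
        _ ≤ 4 * R := by linarith
    have hexpF : Integrable (fun s => exp (pot Bt s)) (haarProbability (Matrix.specialUnitaryGroup (Fin 2) ℂ)) :=
      integrable_of_measurable_of_abs_le hFm.exp (C := exp (4 * R)) fun s => by
        rw [abs_of_nonneg (exp_pos _).le]; exact exp_le_exp.2 ((le_abs_self _).trans (hFκ s))
    haveI : IsProbabilityMeasure ν := isProbabilityMeasure_tilted hexpF
    -- the variance of the observable: the schema
    have hVφ : ∫ s, (φ s - ∫ s', φ s' ∂ν) ^ 2 ∂ν ≤ (Kc * L) ^ 2 / 2 := by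
      have hvar := hP Bt hBt_le φ L hL hφL
      rw [variance_eq_integral hφm.aemeasurable] at hvar
      refine hvar.trans (le_of_eq ?_)
      rw [mul_pow, hKc2]
      ring
    -- the variance of the perturbation: at most its Haar variance (tree)
    have hw2 : ∀ s : (Matrix.specialUnitaryGroup (Fin 2) ℂ), w s ^ 2 = 4 * (((s : (Matrix (Fin 2) (Fin 2) ℂ)) * (B' - B)).trace.re) ^ 2 := fun s => by
      simp only [hw]; ring
    have hEσ : ∫ s, w s ^ 2 ∂(haarProbability (Matrix.specialUnitaryGroup (Fin 2) ℂ)) ≤ 2 * frobNorm (B' - B) ^ 2 := by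
      simp_rw [hw2]
      rw [integral_const_mul, integral_sq_re_trace_su2_mul]
      linarith [coef_sq_le (B' - B)]
    have h4R : 4 * R ≤ 6 / 5 := by linarith
    have hB1 : ∀ g : (Matrix.specialUnitaryGroup (Fin 2) ℂ), |pot Bt g| ≤ 6 / 5 := fun g => (hFκ g).trans h4R
    have hVw : ∫ s, (w s - ∫ s', w s' ∂ν) ^ 2 ∂ν ≤ (2 * frobNorm (B' - B)) ^ 2 / 2 := by
      have hM : (2 * frobNorm (B' - B)) ^ 2 / 2 = 2 * frobNorm (B' - B) ^ 2 := by ring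
      rw [hM]
      have hV := integral_var_tilted_le_six_fifths Bt (B' - B) hB1
      exact hV.trans hEσ
    -- Cauchy–Schwarz
    have hcov := abs_integral_mul_sub_le_of_variance_le (ν := ν) (K := 2) two_pos (mul_nonneg hKc0 hL)
      (mul_nonneg zero_le_two (frobNorm_nonneg _)) hφm hφb hwm ⟨Bw, hwb⟩ hVφ hVw
    refine hcov.trans (le_of_eq ?_)
    ring


/-- Hypothesis-free corollary: **the Bakry–Émery modulus `K(R) = √(2/(1 − 2R))` (R20's `oneLinkKRModulus_su2_var`) now
holds on the larger ball `R ≤ 3/10`.** (The strong-coupling window it yields, `81β_W² + 6β_W < 2`, is unchanged: it closes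
at `β_W = 0.1244 < 1/6` anyway.) [folklore] -/
theorem oneLinkKRModulus_su2_var_threeTenths {R : ℝ} (hR : R ≤ 3 / 10) :
    OneLinkKRModulus 2 R (Real.sqrt (2 / (1 - 2 * R))) := by
  have h12 : 0 < 1 - 2 * R := by linarith
  have h := oneLinkKRModulus_two_of_poincare_threeTenths hR (by positivity) (oneLinkPoincareSU2_bakryEmery (by linarith))
  have e : 2 * (1 / (1 - 2 * R)) = 2 / (1 - 2 * R) := by field_simp
  rwa [e] at h

/-- In the ledger's units: `OneLinkPoincareSU2 (3βW/2) c → OneLinkKRModulusSU2 βW (√(2c)/4)` for `βW ≤ 1/5`, `0 < c`.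
[folklore] -/
theorem oneLinkKRModulusSU2_of_poincare_fifth {βW c : ℝ} (h5 : βW ≤ 1 / 5) (hc : 0 < c)
    (hP : OneLinkPoincareSU2 (3 * βW / 2) c) : OneLinkKRModulusSU2 βW (Real.sqrt (2 * c) / 4) := by
  have h := oneLinkKRModulus_two_of_poincare_threeTenths (R := 3 * βW / 2) (by linarith) hc hP
  have e : 4 * (Real.sqrt (2 * c) / 4) = Real.sqrt (2 * c) := by ring
  show OneLinkKRModulus 2 (3 * βW / 2) (4 * (Real.sqrt (2 * c) / 4))
  rwa [e]

end Modulus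

/-! ## Part D: the doors under the sharp one-link Poincaré hypothesis on the ball `R ≤ 3/10`, up to `β_W < √3/9` -/

section Doors

/-- `K₂ = √(4/3)/4 = 0.2887` on `βW ≤ 1/5` under the hypothesis. [folklore] -/
theorem oneLinkKRModulusSU2_of_threeTenths (hP : OneLinkPoincareSU2 (3 / 10) (2 / 3)) {βW : ℝ} (h5 : βW ≤ 1 / 5) :
    OneLinkKRModulusSU2 βW (Real.sqrt (4 / 3) / 4) := by
  have hP' : OneLinkPoincareSU2 (3 * βW / 2) (2 / 3) := OneLinkPoincareSU2.mono_radius hP (by linarith)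
  have hm := oneLinkKRModulusSU2_of_poincare_fifth h5 (by norm_num) hP'
  have e : (2 : ℝ) * (2 / 3) = 4 / 3 := by norm_num
  rwa [e] at hm

/-- `√3/9 < 1/5` (so the whole window lies inside the radius range `βW ≤ 1/5`). [folklore] -/
theorem sqrt_three_div_nine_lt_fifth : Real.sqrt 3 / 9 < 1 / 5 := by
  have hs : Real.sqrt 3 < 9 / 5 := by
    rw [Real.sqrt_lt' (by norm_num)]; norm_num
  linarith

/-- SC-b up to the sharp-Poincaré window: `OneLinkPoincareSU2 (3/10) (2/3) → StrongCouplingFront (fundamentalLatticeRep 2)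
(β₀W/2)` for every `0 ≤ β₀W < √3/9 = 0.19245…` (the tree's door `su2_strongCouplingFront_of_oneLinkKRModulus`).
CONDITIONAL; the owned hypothesis-free number is `0.124`. [folklore] -/
theorem su2_strongCouplingFront_of_threeTenths (hP : OneLinkPoincareSU2 (3 / 10) (2 / 3)) {β₀W : ℝ} (h0 : 0 ≤ β₀W)
    (hlt : β₀W < Real.sqrt 3 / 9) : CrossoverLedger.StrongCouplingFront (fundamentalLatticeRep 2) (β₀W / 2) :=
  su2_strongCouplingFront_of_oneLinkKRModulus (by positivity)
    (oneLinkKRModulusSU2_of_threeTenths hP (by linarith [sqrt_three_div_nine_lt_fifth]))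
    ((su2_sharpPoincare_window_iff h0).2 hlt)

/-- SC-a up to the sharp-Poincaré window: `OneLinkPoincareSU2 (3/10) (2/3) → DLRMassGapAt 4 2 (βW/4)` for every
`0 ≤ βW < √3/9` (the tree's door `su2_dlrMassGapAt_of_oneLinkKRModulus`).  CONDITIONAL. [folklore] -/
theorem su2_dlrMassGapAt_of_threeTenths (hP : OneLinkPoincareSU2 (3 / 10) (2 / 3)) {βW : ℝ} (h0 : 0 ≤ βW)
    (hlt : βW < Real.sqrt 3 / 9) : DLRMassGapAt 4 2 (βW / 4) :=
  su2_dlrMassGapAt_of_oneLinkKRModulus h0 (by positivity)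
    (oneLinkKRModulusSU2_of_threeTenths hP (by linarith [sqrt_three_div_nine_lt_fifth]))
    ((su2_sharpPoincare_window_iff h0).2 hlt)

/-- SC-c up to the sharp-Poincaré window: `OneLinkPoincareSU2 (3/10) (2/3) → LatticeMassGap (fundamentalRep (Fin 2)) (βW/2)
(krRate (18 βW K₂))`, `K₂ = √(4/3)/4`, for every `0 ≤ βW < √3/9` (the tree's door `su2_latticeMassGap_of_oneLinkKRModulusSU2`).
CONDITIONAL. [folklore] -/
theorem su2_latticeMassGap_of_threeTenths (hP : OneLinkPoincareSU2 (3 / 10) (2 / 3)) {βW : ℝ} (h0 : 0 ≤ βW)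
    (hlt : βW < Real.sqrt 3 / 9) :
    CrossoverLedger.LatticeMassGap (fundamentalRep (Fin 2)) (βW / 2) (krRate (18 * βW * (Real.sqrt (4 / 3) / 4))) :=
  su2_latticeMassGap_of_oneLinkKRModulusSU2 h0 (by positivity)
    (oneLinkKRModulusSU2_of_threeTenths hP (by linarith [sqrt_three_div_nine_lt_fifth]))
    ((su2_sharpPoincare_window_iff h0).2 hlt)

/-! ### Plug-in doors for ANY Poincaré constant `c` on the ball of radius `3/10`

A future (partial or sharp) kernel proof of `OneLinkPoincareSU2 (3/10) c` converts into the three doors on the window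
`81 β_W² c < 2`, `β_W ≤ 1/5`, by the three one-liners below (e.g. `c = 0.8` gives `β_W < 0.1757`, `c = 3/4` gives
`0.1814`, `c = 2/3` gives `√3/9 = 0.19245`); the Bakry–Émery value is `c = 1/(1 − 2R) = 5/2` at `R = 3/10`, but the
member relevant at `β_W` is `c = 1/(1 − 3β_W)`, handled by R20/R22 directly. -/

/-- SC-b for any constant: `0 < c → OneLinkPoincareSU2 (3/10) c → 0 ≤ β₀W ≤ 1/5 → 81 β₀W² c < 2 →
StrongCouplingFront (fundamentalLatticeRep 2) (β₀W/2)`.  CONDITIONAL on the stated hypothesis. [folklore] -/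
theorem su2_strongCouplingFront_of_poincare_threeTenths {c : ℝ} (hc : 0 < c) (hP : OneLinkPoincareSU2 (3 / 10) c)
    {β₀W : ℝ} (h0 : 0 ≤ β₀W) (h5 : β₀W ≤ 1 / 5) (hw : 81 * β₀W ^ 2 * c < 2) :
    CrossoverLedger.StrongCouplingFront (fundamentalLatticeRep 2) (β₀W / 2) :=
  su2_strongCouplingFront_of_oneLinkKRModulus (by positivity)
    (oneLinkKRModulusSU2_of_poincare_fifth h5 hc (OneLinkPoincareSU2.mono_radius hP (by linarith)))
    ((su2_window_iff_of_poincare h0 hc).2 hw)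

/-- SC-a for any constant: `0 < c → OneLinkPoincareSU2 (3/10) c → 0 ≤ βW ≤ 1/5 → 81 βW² c < 2 → DLRMassGapAt 4 2 (βW/4)`.
CONDITIONAL on the stated hypothesis. [folklore] -/
theorem su2_dlrMassGapAt_of_poincare_threeTenths {c : ℝ} (hc : 0 < c) (hP : OneLinkPoincareSU2 (3 / 10) c)
    {βW : ℝ} (h0 : 0 ≤ βW) (h5 : βW ≤ 1 / 5) (hw : 81 * βW ^ 2 * c < 2) : DLRMassGapAt 4 2 (βW / 4) :=
  su2_dlrMassGapAt_of_oneLinkKRModulus h0 (by positivity)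
    (oneLinkKRModulusSU2_of_poincare_fifth h5 hc (OneLinkPoincareSU2.mono_radius hP (by linarith)))
    ((su2_window_iff_of_poincare h0 hc).2 hw)

/-- SC-c for any constant: `0 < c → OneLinkPoincareSU2 (3/10) c → 0 ≤ βW ≤ 1/5 → 81 βW² c < 2 →
LatticeMassGap (fundamentalRep (Fin 2)) (βW/2) (krRate (18 βW √(2c)/4))`.  CONDITIONAL on the stated hypothesis. [folklore] -/
theorem su2_latticeMassGap_of_poincare_threeTenths {c : ℝ} (hc : 0 < c) (hP : OneLinkPoincareSU2 (3 / 10) c)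
    {βW : ℝ} (h0 : 0 ≤ βW) (h5 : βW ≤ 1 / 5) (hw : 81 * βW ^ 2 * c < 2) :
    CrossoverLedger.LatticeMassGap (fundamentalRep (Fin 2)) (βW / 2) (krRate (18 * βW * (Real.sqrt (2 * c) / 4))) :=
  su2_latticeMassGap_of_oneLinkKRModulusSU2 h0 (by positivity)
    (oneLinkKRModulusSU2_of_poincare_fifth h5 hc (OneLinkPoincareSU2.mono_radius hP (by linarith)))
    ((su2_window_iff_of_poincare h0 hc).2 hw)

end Doors

end Summit.QuantumFields.BalabanUV.InfraRed.StrongCouplingSixFifthsWindow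

end
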